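import Summits.AtomisticToContinuum.HydrodynamicLimit.Theses.AntiMazurCoboundaries
import Summits.AtomisticToContinuum.HydrodynamicLimit.Theses.FluxGibbsianityLdDrude
import Summits.AtomisticToContinuum.HydrodynamicLimit.Theorems.KineticFluxLdDecay.Negative.TiltBasics
import Literature.Analysis.FluidPDE.HardSphereCollisionRecord
import Literature.Analysis.FluidPDE.HardSphereFlowJointMeasurable
import Literature.Analysis.FluidPDE.HardSphereFlowMeasurable
import Literature.MathematicalPhysics.KineticTheory.HardSphereTwoTimePressure
import Literature.MathematicalPhysics.KineticTheory.HardSphereEulerProofs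

/-!
# Line `dynkin-azuma-collision-innovations` — checked skeleton for the crux `KineticFluxLdDecay`
(stmt-AtomisticToContinuum-10967; wanted by routes AntiMazurCoboundaries r4 and FluxGibbsianityLdDrude r2,
byte-identical decls — `KineticFluxLdDecay_of` concludes the former BY NAME, `KineticFluxLdDecay_of'` the latter)

crux-plan seat `planner-cruxplan-stmt-AtomisticToContinuum-10967-dynkin-azuma-collisi-0`, 2026-08-16.
Idea card `Cruxes/KineticFluxLdDecay/Ideas/dynkin-azuma-collision-innovations.md` (ideator 1, triage r1: pass ×3
with two mandatory repairs, both made here); line card `Lines/dynkin-azuma-collision-innovations.md`.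

## The line in one identity

With the Chapman–Enskog profile `ψ₀ = L⁻¹ g` (stub S1; solvable EXACTLY because `g ⊥ span{1,v,|v|²}`), the
corrector normalisation `ψ = c ℓ ψ₀` (`c = c(σ,a,θ)` supplied by S6 — the HALVED booking of triage finding (A):
the one-body Hájek projection of the TRUE compensator of the collision payloads is `h·B`, not `2h·B`), a
`D`-Lipschitz regularisation `φ'` of the test function (S2), the per-particle clamp at the `K = ⌈kτ⌉`-th
collision of the window (`stopTime`, `obsB`), the binned clipped payloads `Ỹₙ` of the RELEVANT collisions
(those with a counted participant; at most `(N+1)(K+1)` on a good orbit, enumerated in time by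
`Literature.Analysis.FluidPDE.nthTimeAfter`) and their partial sums `X̃` (`procX`), and ANY filtration `ℱ`:

  `A_φ = (A_φ − A_φ') + (A_φ' − B) + h⁻¹ X̃ₘ − h⁻¹ M − h⁻¹ R`   (everywhere; `obsB_eq`)

where `M = martingalePart X̃ ℱ G_N m` (INNOVATIONS, `innov`), `C = predictablePart X̃ ℱ G_N m` (COMPENSATOR,
`comp`) and `R := C − h·B` (PREDICTABLE COMPENSATOR DEFECT, `defect`) — Mathlib's Doob decomposition
`martingalePart_add_predictablePart`. Five-term exponential convexity at tilt `5` (`exp_add_five_le`) and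
`|A_φ' − B| ≤ 2κ·#busy` on good orbits (`clampRem_le`) reduce the crux to five pressure bounds:
S2 (regularisation error, static), S4 (few busy particles), S3 (the clamped jump sum `X̃ₘ` is a free
term: Dynkin/corrector balance + Gaussian speed moments), S5 (Azuma–Hoeffding for `M`: increments `≤ R =
8cℓ(b+δ₀)`, `m = (N+1)(K+1)` of them ⇒ rate `1/n_c` UNIFORMLY IN N, no chaos hypothesis), and S6 = C⁺,
THE BET: `R/h` has vanishing window pressure below an absolute amplitude, along some filtration of the
coarse causal class `ℱ n ≤ causalSigma n` (generated by DISCRETE marks — triage finding (B): exact marks pin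
the microstate after O(1) collisions per particle and would make `M ≡ 0`, `C⁺ ≡ crux`; countably-valued
marks have atoms and cannot pin anything, at every resolution).

## Stubs (registered; `sorry` only inside them) — hardest: `stub_compensatorDefect`

* `stub_skeletonBookkeeping` (S0, definitional, lead): increments/cap of `X̃`, the Doob identity
  `B = h⁻¹X̃ₘ - h⁻¹M - h⁻¹R`, monotonicity of the causal record σ-algebras — lands with the objects module `Theorems/AntiMazurCoboundariesKineticFluxLdDecayObjects.lean`.

* `stub_chapmanEnskogInverse` (S1, M–L): bounded continuous `L⁻¹` on bounded continuous `g ⊥` invariants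
  (Grad 1963; CIP1994 §7.2; tree: kernel + gap of `hardSphereLinearizedOp` PROVED, no inverse yet).
  `temperateGrowth` dropped per TRIAGE-r1-1/2 (the typed `ChapmanEnskogInverseBounded` was false).
* `stub_lipschitzRegularisation` (S2, M): McShane Lipschitz approximation of `φ` on `𝕋³` + STATIC pressure
  bound for the difference functional (Jensen in time, invariance of `G_N`, i.i.d. Gaussian velocities).
* `stub_clampedJumpPressure` (S3, M–L): `E_G exp(p h⁻¹ X̃ₘ) ≤ e^{δ(N+1)}` — binning error deterministic,
  Abel summation of each particle's counted jumps into boundary `≤ 2cℓb` + streaming `≤ cℓbD∫|vᵢ|`.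
* `stub_fewBusyParticles` (S4, L): `E_G exp(lam·#{i : ≥ ⌈kτ⌉+1 collisions in (0,τℓ]}) ≤ e^{δ(N+1)}` for
  `k ≥ k₀(lam,δ)` — payload per PARTICLE (the refuted ex-crux 14441 shows per-COLLISION payloads are hopeless).
* `stub_azumaHoeffding` (S5, M): generic Azuma–Hoeffding for Doob martingale parts (Mathlib has the
  sub-Gaussian martingale sum `HasSubgaussianMGF.sum_of_hasCondSubgaussianMGF`, not conditional Hoeffding).
* `stub_compensatorDefect` (S6 = C⁺, open): the bet, with the amplitude threshold `|p|·b ≤ s₀` that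
  `Disproof.kineticFluxLdDecay_false_allAmplitudes` makes necessary.

## Disproof.lean (cdisprove cycle 1) used

`kineticFluxLdDecay_false_without_orthogonality` (PROVED): honoured at S1 (the orthogonality clause is the solvability
condition of `Lψ₀ = g`; `1 ∈ ker L`) and S6 (same hypothesis). Near-misses `…_without_orthVel`,
`…_without_orthEnergy`: same (`v, |v|² ∈ ker L`). `…_false_allAmplitudes`: the threshold `s₀` of S6 and the
composition's choice `κ = s₀ / (5·max(1,C₀))`. `tiltFunctional_nonpos_of_admissible` (near-miss): consistent —
Gibbs tilts act on `R` at second order only. Landed `Theorems/KineticFluxLdDecay/Negative/TiltBasics` is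
imported: it contains no lemma bearing on S1–S6 (Gaussian/Jensen helpers). Negatives index (12 items): none
on LD-Drude, collision counts, or Chapman–Enskog; TwoClocks ex-crux 14441 (paper-refuted, dense fcc blob)
shaped S4.
-/

noncomputable section

open MeasureTheory ProbabilityTheory Set Filter
open scoped ENNReal BigOperators
open Literature.Analysis.FluidPDE Literature.MathematicalPhysics.KineticTheory
open Literature.Analysis.UnboundedOperators (hardSphereLinearizedOp)

namespace Summit.AtomisticToContinuum.HydrodynamicLimit.Cruxes.KineticFluxLdDecay.DynkinAzumaCollisionInnovations

open Summit.AtomisticToContinuum.HydrodynamicLimit.Theses.AntiMazurCoboundaries (KineticFluxLdDecay)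

/-! ## § 0 Frame (the crux's objects, named) -/

/-- The hard-sphere flows of the crux: `N + 1` spheres of diameter `σ (N+1)^{-1/3}` on `𝕋³`. -/
abbrev Flow (σ : ℝ) (N : ℕ) : Type :=
  HardSphereFlow (Torus.geometry (Fin 3)) (hsDiameter σ N) (N + 1)

/-- Phase space of `N + 1` spheres on `𝕋³`. -/
abbrev Phase (N : ℕ) : Type := Config (N + 1) (Fin 3) T3

/-- The homogeneous Gibbs law `G_N` of the crux. -/
abbrev gibbs (σ a θ : ℝ) (u₀ : V3) (N : ℕ) (Φ : Flow σ N) : Measure (Phase N) :=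
  localGibbsLaw σ (fun _ => a) (fun _ => u₀) (fun _ => θ) N Φ

/-- The macroscopic interparticle scale `ℓ_N = (N+1)^{-1/3}`. -/
def ell (N : ℕ) : ℝ := ((N + 1 : ℕ) : ℝ) ^ (-(1 / 3 : ℝ))

/-- The kinetic window `h = τ ℓ_N`. -/
def window (τ : ℝ) (N : ℕ) : ℝ := τ * ((N + 1 : ℕ) : ℝ) ^ (-(1 / 3 : ℝ))

/-- Scaled peculiar velocity `w = (v - u₀)/√θ` (standard Gaussian under `G_N`). -/
def sv (θ : ℝ) (u₀ : V3) (v : V3) : V3 := (Real.sqrt θ)⁻¹ • (v - u₀)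

/-- The crux's window functional `A(z) = h⁻¹ ∫₀ʰ F(Φ_s z) ds`, `F(z) = ∑ᵢ φ(xᵢ) g(wᵢ)` (literally the
integrand of `KineticFluxLdDecay`). -/
def obsA (θ : ℝ) (u₀ : V3) (φ : T3 → ℝ) (g : V3 → ℝ) (τ : ℝ) {σ : ℝ} {N : ℕ} (Φ : Flow σ N)
    (z : Phase N) : ℝ :=
  (window τ N)⁻¹ * ∫ s in (0 : ℝ)..window τ N,
    ∑ i, φ (Φ.flow s z i).1 * g (sv θ u₀ (Φ.flow s z i).2)

/-! ## § 1 The per-particle clamp at the `K`-th collision of the window -/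

/-- The number of collisions of particle `i` in the window `(0, h]` along the orbit of `z`
(`Set.ncard`; finite on good orbits, junk `0` otherwise). -/
def collCount {σ : ℝ} {N : ℕ} (Φ : Flow σ N) (h : ℝ) (i : Fin (N + 1)) (z : Phase N) : ℕ :=
  (collisionTimesOf (Torus.geometry (Fin 3)) (hsDiameter σ N) (fun s => Φ.flow s z) i ∩
    Set.Ioc 0 h).ncard

open scoped Classical in
/-- Particle `i` is **busy** in the window `(0, h]`: it has at least `K + 1` collisions there
(guarded by the good set, so that every orbit functional below is junk-free off `Φ.good`).
Boolean-valued (decided classically), so that it is data, not a proposition. -/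
def busy {σ : ℝ} {N : ℕ} (Φ : Flow σ N) (K : ℕ) (h : ℝ) (i : Fin (N + 1)) (z : Phase N) : Bool :=
  decide (z ∈ Φ.good ∧ K + 1 ≤ collCount Φ h i z)

/-- The number of busy particles. -/
def busyCount {σ : ℝ} {N : ℕ} (Φ : Flow σ N) (K : ℕ) (h : ℝ) (z : Phase N) : ℕ :=
  (Finset.univ.filter fun i => busy Φ K h i z = true).card

/-- The **stopping time** of particle `i`: the time of its collision of index `K` (0-based, after
time `0`; `HardSphereFlow.nthCollisionTimeOf`) if `i` is busy — clamped into `[0, h]`, which is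
inactive on good orbits — else `h`. Particle `i`'s collisions at times `≤ stopTime` (its first
`K + 1` in the window) are the COUNTED ones. -/
def stopTime {σ : ℝ} {N : ℕ} (Φ : Flow σ N) (K : ℕ) (h : ℝ) (i : Fin (N + 1)) (z : Phase N) : ℝ :=
  if busy Φ K h i z = true then max 0 (min h (Φ.nthCollisionTimeOf i K z)) else h

/-- The **clamped window functional** `B(z) = h⁻¹ ∑ᵢ ∫₀^{Tᵢ} φ(xᵢ(s)) g(wᵢ(s)) ds`: each particle's
contribution stopped at its `K`-th collision. -/
def obsB (θ : ℝ) (u₀ : V3) (φ : T3 → ℝ) (g : V3 → ℝ) (τ : ℝ) (K : ℕ) {σ : ℝ} {N : ℕ} (Φ : Flow σ N)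
    (z : Phase N) : ℝ :=
  (window τ N)⁻¹ * ∑ i, ∫ s in (0 : ℝ)..stopTime Φ K (window τ N) i z,
    φ (Φ.flow s z i).1 * g (sv θ u₀ (Φ.flow s z i).2)

/-! ## § 2 The relevant (counted) collisions of the window and their enumeration -/

open scoped Classical in
/-- Particle `i` is a **counted participant** of the collision happening at time `t` along the orbit
of `z`: it participates and `t ≤ stopTime` (the collision is among its first `K + 1`).
Boolean-valued (decided classically). -/
def counted {σ : ℝ} {N : ℕ} (Φ : Flow σ N) (K : ℕ) (h t : ℝ) (i : Fin (N + 1)) (z : Phase N) : Bool :=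
  decide (Participates (Torus.geometry (Fin 3)) (hsDiameter σ N) (Φ.flow t z) i ∧ t ≤ stopTime Φ K h i z)

/-- The **relevant collision times** of the window: collision times in `(0, h]` with at least one
counted participant. On a good orbit there are at most `(N+1)(K+1)` of them. -/
def relTimes {σ : ℝ} {N : ℕ} (Φ : Flow σ N) (K : ℕ) (h : ℝ) (z : Phase N) : Set ℝ :=
  {t | t ∈ collisionTimes (Torus.geometry (Fin 3)) (hsDiameter σ N) (fun s => Φ.flow s z) ∧
    t ∈ Set.Ioc 0 h ∧ ∃ i, counted Φ K h t i z = true}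

/-- The number of relevant collisions of the window (finite on good orbits; junk `0` otherwise). -/
def relCount {σ : ℝ} {N : ℕ} (Φ : Flow σ N) (K : ℕ) (h : ℝ) (z : Phase N) : ℕ :=
  (relTimes Φ K h z).ncard

/-- The time of the `n`-th relevant collision (`n = 0` the first), enumerated in increasing order
from time `0` (`Literature.Analysis.FluidPDE.nthTimeAfter`; junk beyond `relCount`). -/
def relTime {σ : ℝ} {N : ℕ} (Φ : Flow σ N) (K : ℕ) (h : ℝ) (z : Phase N) (n : ℕ) : ℝ :=
  nthTimeAfter (relTimes Φ K h z) 0 n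

/-- The deterministic martingale horizon `m = (N+1)(K+1) ≥ relCount` (on good orbits). -/
def horizon (N K : ℕ) : ℕ := (N + 1) * (K + 1)

/-! ## § 3 Discrete marks, the binned collision payload and the causal coarse record -/

/-- Binning of a real at resolution `r`: the integer label `⌊x / r⌋`. -/
def bin (r x : ℝ) : ℤ := ⌊x / r⌋

/-- The binned value `r ⌊x / r⌋` (within `r` of `x`). -/
def binVal (r x : ℝ) : ℝ := r * (bin r x : ℝ)

/-- Binning of a velocity, coordinatewise. -/
def binVec (r : ℝ) (w : V3) : Fin 3 → ℤ := fun k => bin r (w k)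

/-- Symmetric clipping at level `R`. -/
def clip (R x : ℝ) : ℝ := max (-R) (min R x)

/-- The pre-collisional velocity of particle `i` in the configuration `z'` reached at a collision
(read off through the elastic involution, `HardSphereCollisionRecord.ofConfig`; junk if `i` does not
participate). -/
def preVelOf {σ : ℝ} {N : ℕ} (z' : Phase N) (i : Fin (N + 1)) : V3 :=
  (HardSphereCollisionRecord.ofConfig (Torus.geometry (Fin 3)) (hsDiameter σ N) z' 0 i
    (partner (Torus.geometry (Fin 3)) (hsDiameter σ N) z' i)).preVel.1

/-- The **discrete mark of one particle** at a collision instant: cell of its position (mesh `δx`),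
binned post- and pre-collisional scaled velocities (mesh `δv`), binned value of the test function
`φ'` at its position (mesh `δφ`), binned values of the Chapman–Enskog profile `ψ₀` at its post- and
pre-collisional scaled velocities (mesh `δ₀`), and the two flags (participates, counted). -/
abbrev ParticleMark : Type :=
  (Fin 3 → ℤ) × (Fin 3 → ℤ) × (Fin 3 → ℤ) × ℤ × ℤ × ℤ × Bool × Bool

/-- The discrete mark of a collision instant: time slot (mesh `δt`) and every particle's mark. -/
abbrev Mark (N : ℕ) : Type := ℤ × (Fin (N + 1) → ParticleMark)

open scoped Classical in
/-- The mark of particle `i` at time `t` along the orbit of `z`. -/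
def particleMarkAt (θ : ℝ) (u₀ : V3) (φ' : T3 → ℝ) (ψ₀ : V3 → ℝ) (K : ℕ) (h δx δv δφ δ₀ : ℝ)
    {σ : ℝ} {N : ℕ} (Φ : Flow σ N) (t : ℝ) (z : Phase N) (i : Fin (N + 1)) : ParticleMark :=
  let z' := Φ.flow t z
  (Torus.coarseCell δx (z' i).1,
   binVec δv (sv θ u₀ (z' i).2),
   binVec δv (sv θ u₀ (preVelOf (σ := σ) z' i)),
   bin δφ (φ' (z' i).1),
   bin δ₀ (ψ₀ (sv θ u₀ (z' i).2)),
   bin δ₀ (ψ₀ (sv θ u₀ (preVelOf (σ := σ) z' i))),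
   decide (Participates (Torus.geometry (Fin 3)) (hsDiameter σ N) z' i),
   counted Φ K h t i z)

/-- The mark of the collision instant `t` along the orbit of `z`. -/
def markAt (θ : ℝ) (u₀ : V3) (φ' : T3 → ℝ) (ψ₀ : V3 → ℝ) (K : ℕ) (h δt δx δv δφ δ₀ : ℝ)
    {σ : ℝ} {N : ℕ} (Φ : Flow σ N) (t : ℝ) (z : Phase N) : Mark N :=
  (bin δt t, fun i => particleMarkAt θ u₀ φ' ψ₀ K h δx δv δφ δ₀ Φ t z i)

/-- The **binned, clamped payload of one particle's jump** at the collision instant `t`: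
`c ℓ · φ̃'(xᵢ) · (ψ̃₀(wᵢ⁺) - ψ̃₀(wᵢ⁻))` if `i` is a counted participant, else `0` (binned values, so
it is a function of the particle's discrete mark). -/
def payloadAt (θ : ℝ) (u₀ : V3) (φ' : T3 → ℝ) (ψ₀ : V3 → ℝ) (c : ℝ) (K : ℕ) (h δφ δ₀ : ℝ)
    {σ : ℝ} {N : ℕ} (Φ : Flow σ N) (t : ℝ) (z : Phase N) (i : Fin (N + 1)) : ℝ :=
  if counted Φ K h t i z = true then
    c * ell N * binVal δφ (φ' (Φ.flow t z i).1) *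
      (binVal δ₀ (ψ₀ (sv θ u₀ (Φ.flow t z i).2)) -
        binVal δ₀ (ψ₀ (sv θ u₀ (preVelOf (σ := σ) (Φ.flow t z) i))))
  else 0

/-- The payload cap `R = 8 c ℓ (b + δ₀)` (`b` a bound on `|ψ₀|`; on good orbits, where collisions
are binary and `|φ̃'| ≤ 2`, clipping at `R` is inactive). -/
def payloadCap (c b δ₀ : ℝ) (N : ℕ) : ℝ := 8 * c * ell N * (b + δ₀)

open scoped Classical in
/-- The **binned payload `Ỹₙ` of the `n`-th relevant collision** (sum over counted participants,
clipped at the cap; `0` beyond `relCount` and off the good set). -/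
def payloadY (θ : ℝ) (u₀ : V3) (φ' : T3 → ℝ) (ψ₀ : V3 → ℝ) (c b : ℝ) (K : ℕ) (τ δφ δ₀ : ℝ)
    {σ : ℝ} {N : ℕ} (Φ : Flow σ N) (n : ℕ) (z : Phase N) : ℝ :=
  if z ∈ Φ.good ∧ n < relCount Φ K (window τ N) z then
    clip (payloadCap c b δ₀ N)
      (∑ i, payloadAt θ u₀ φ' ψ₀ c K (window τ N) δφ δ₀ Φ (relTime Φ K (window τ N) z n) z i)
  else 0

/-- The **partial-sum process `X̃ₙ = ∑_{m<n} Ỹₘ`** of binned collision payloads (`X̃₀ = 0`). -/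
def procX (θ : ℝ) (u₀ : V3) (φ' : T3 → ℝ) (ψ₀ : V3 → ℝ) (c b : ℝ) (K : ℕ) (τ δφ δ₀ : ℝ)
    {σ : ℝ} {N : ℕ} (Φ : Flow σ N) (n : ℕ) (z : Phase N) : ℝ :=
  ∑ m ∈ Finset.range n, payloadY θ u₀ φ' ψ₀ c b K τ δφ δ₀ Φ m z

open scoped Classical in
/-- The **causal coarse record** up to (excluding) the `n`-th relevant collision: the marks of the
relevant collisions `0, …, n-1` (masked beyond `relCount` and off the good set; `Ỹₘ`, `m < n`, is a
fixed function of it, so `X̃` is adapted to any filtration between `σ(X̃)` and `causalSigma`). -/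
def record (θ : ℝ) (u₀ : V3) (φ' : T3 → ℝ) (ψ₀ : V3 → ℝ) (K : ℕ) (τ δt δx δv δφ δ₀ : ℝ)
    {σ : ℝ} {N : ℕ} (Φ : Flow σ N) (n : ℕ) (z : Phase N) : ℕ → Bool × Mark N :=
  fun m =>
    if z ∈ Φ.good ∧ m < n ∧ m < relCount Φ K (window τ N) z then
      (true, markAt θ u₀ φ' ψ₀ K (window τ N) δt δx δv δφ δ₀ Φ (relTime Φ K (window τ N) z m) z)
    else (false, default)

/-- The **σ-algebra of the causal coarse record** before the `n`-th relevant collision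
(`MeasurableSpace.comap` of `record`; generated by countably-valued marks, hence atomic: no filtration
below it can pin the microstate). -/
@[reducible] def causalSigma (θ : ℝ) (u₀ : V3) (φ' : T3 → ℝ) (ψ₀ : V3 → ℝ) (K : ℕ) (τ δt δx δv δφ δ₀ : ℝ)
    {σ : ℝ} {N : ℕ} (Φ : Flow σ N) (n : ℕ) : MeasurableSpace (Phase N) :=
  MeasurableSpace.comap (record θ u₀ φ' ψ₀ K τ δt δx δv δφ δ₀ Φ n) inferInstance

/-! ## § 4 Doob decomposition along a coarse collision filtration: innovations and compensator defect -/

/-- The **innovation martingale** `M = martingalePart X̃` at the horizon, for a filtration `ℱ`. -/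
def innov (a θ : ℝ) (u₀ : V3) (φ' : T3 → ℝ) (ψ₀ : V3 → ℝ) (c b : ℝ) (K : ℕ) (τ δφ δ₀ : ℝ)
    {σ : ℝ} {N : ℕ} (Φ : Flow σ N) (ℱ : Filtration ℕ (inferInstance : MeasurableSpace (Phase N)))
    (z : Phase N) : ℝ :=
  martingalePart (procX θ u₀ φ' ψ₀ c b K τ δφ δ₀ Φ) ℱ (gibbs σ a θ u₀ N Φ) (horizon N K) z

/-- The **compensator** `C = predictablePart X̃` at the horizon, for a filtration `ℱ`. -/
def comp (a θ : ℝ) (u₀ : V3) (φ' : T3 → ℝ) (ψ₀ : V3 → ℝ) (c b : ℝ) (K : ℕ) (τ δφ δ₀ : ℝ)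
    {σ : ℝ} {N : ℕ} (Φ : Flow σ N) (ℱ : Filtration ℕ (inferInstance : MeasurableSpace (Phase N)))
    (z : Phase N) : ℝ :=
  predictablePart (procX θ u₀ φ' ψ₀ c b K τ δφ δ₀ Φ) ℱ (gibbs σ a θ u₀ N Φ) (horizon N K) z

/-- The **predictable compensator defect** `R = C - h·B`: the compensator of the clamped binned
collision payloads minus the clamped window integral of `F' = ∑ φ'(xᵢ) g(wᵢ)`, `g = L ψ₀`. -/
def defect (a θ : ℝ) (u₀ : V3) (φ' : T3 → ℝ) (ψ₀ g : V3 → ℝ) (c b : ℝ) (K : ℕ) (τ δφ δ₀ : ℝ)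
    {σ : ℝ} {N : ℕ} (Φ : Flow σ N) (ℱ : Filtration ℕ (inferInstance : MeasurableSpace (Phase N)))
    (z : Phase N) : ℝ :=
  comp a θ u₀ φ' ψ₀ c b K τ δφ δ₀ Φ ℱ z - window τ N * obsB θ u₀ φ' g τ K Φ z


/-! ## § 5 The stubs (registered obligations of the line; `sorry` only here) -/

/-- **S0 · skeleton bookkeeping** (definitional facts about the line's objects, registered so that
the objects module `Theorems/AntiMazurCoboundariesKineticFluxLdDecayObjects.lean` lands them
together with the definitions): (i) the payload process starts at `0` and its increments — the
clipped payloads — are bounded by the non-negative cap `8cℓ(b+δ₀)` (inputs of Azuma, S5);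
(ii) the EXACT PATHWISE IDENTITY `B = h⁻¹X̃ₘ - h⁻¹M - h⁻¹R` (Mathlib's Doob decomposition
`martingalePart_add_predictablePart`, for every filtration); (iii) the causal coarse record
σ-algebras increase with the collision index (the record before collision `n` is a measurable
function of the record before collision `n+1`). -/
theorem stub_skeletonBookkeeping :
    (∀ (θ : ℝ) (u₀ : V3) (φ' : T3 → ℝ) (ψ₀ : V3 → ℝ) (c b : ℝ) (K : ℕ) (τ δφ δ₀ : ℝ),
      0 ≤ c → 0 ≤ b → 0 ≤ δ₀ → ∀ (σ : ℝ) (N : ℕ) (Φ : Flow σ N),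
        0 ≤ payloadCap c b δ₀ N ∧
        (∀ z : Phase N, procX θ u₀ φ' ψ₀ c b K τ δφ δ₀ Φ 0 z = 0) ∧
        ∀ (n : ℕ) (z : Phase N),
          |procX θ u₀ φ' ψ₀ c b K τ δφ δ₀ Φ (n + 1) z - procX θ u₀ φ' ψ₀ c b K τ δφ δ₀ Φ n z| ≤
            payloadCap c b δ₀ N) ∧
    (∀ (a θ : ℝ) (u₀ : V3) (φ' : T3 → ℝ) (ψ₀ g : V3 → ℝ) (c b : ℝ) (K : ℕ) (τ δφ δ₀ : ℝ)
      (σ : ℝ) (N : ℕ) (Φ : Flow σ N) (ℱ : Filtration ℕ (inferInstance : MeasurableSpace (Phase N))),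
      0 < τ → ∀ z : Phase N,
        obsB θ u₀ φ' g τ K Φ z =
          (window τ N)⁻¹ * procX θ u₀ φ' ψ₀ c b K τ δφ δ₀ Φ (horizon N K) z -
          (window τ N)⁻¹ * innov a θ u₀ φ' ψ₀ c b K τ δφ δ₀ Φ ℱ z -
          (window τ N)⁻¹ * defect a θ u₀ φ' ψ₀ g c b K τ δφ δ₀ Φ ℱ z) ∧
    (∀ (θ : ℝ) (u₀ : V3) (φ' : T3 → ℝ) (ψ₀ : V3 → ℝ) (K : ℕ) (τ δt δx δv δφ δ₀ : ℝ)
      (σ : ℝ) (N : ℕ) (Φ : Flow σ N) (n : ℕ),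
      causalSigma θ u₀ φ' ψ₀ K τ δt δx δv δφ δ₀ Φ n ≤
        causalSigma θ u₀ φ' ψ₀ K τ δt δx δv δφ δ₀ Φ (n + 1)) := by
  sorry

/-- **S1 · bounded Chapman–Enskog inverse** (Grad's sup-norm theory of `L⁻¹`; CIP 1994 §7.2,
Grad 1963): every bounded continuous `g ⊥ span{1, v, |v|²}` has a bounded continuous pre-image
`ψ₀` under the in-tree linearised hard-sphere operator, `L ψ₀ = g` pointwise, `‖ψ₀‖_∞ ≤ C₀ ‖g‖_∞`.
Solvability is EXACTLY the orthogonality clause (Fredholm alternative: `ker L = span{1,v,|v|²}`),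
so the line honours `Disproof.kineticFluxLdDecay_false_without_orthogonality` here. -/
theorem stub_chapmanEnskogInverse :
    ∃ C₀ : ℝ, 0 < C₀ ∧ ∀ (g : V3 → ℝ) (b : ℝ), Continuous g → (∀ v, |g v| ≤ b) →
      (∀ (c₀ c₂ : ℝ) (e : V3),
        ∫ v, g v * (c₀ + inner ℝ e v + c₂ * ‖v‖ ^ 2) ∂(stdGaussian V3) = 0) →
      ∃ ψ₀ : V3 → ℝ, Continuous ψ₀ ∧ (∀ v, |ψ₀ v| ≤ C₀ * b) ∧ hardSphereLinearizedOp ψ₀ = g := by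
  sorry

/-- **S2 · Lipschitz regularisation of the test function is LD-free** (McShane inf-convolution on
the compact torus + the STATIC pressure bound: Jensen in time under the invariant `G_N`, then the
product structure of `G_N` — velocities i.i.d. standard Gaussian in the scaled variable, independent
of positions — and `log E e^{c g(w)} ≤ (ηb)² e^{ηb}/2` for `|c| ≤ η`, `E g = 0`, `|g| ≤ b`). -/
theorem stub_lipschitzRegularisation :
    ∀ (a θ : ℝ) (u₀ : V3), 0 < a → 0 < θ → ∀ σ : ℝ, 0 < σ → σ ≤ 1 / 2 →
      ∀ (φ : T3 → ℝ) (g : V3 → ℝ) (b : ℝ), Continuous φ → Continuous g → (∀ x, |φ x| ≤ 1) →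
        (∀ v, |g v| ≤ b) → ∫ v, g v ∂(stdGaussian V3) = 0 →
        ∀ η : ℝ, 0 < η →
          ∃ (φ' : T3 → ℝ) (D : ℝ), Continuous φ' ∧ (∀ x, |φ' x| ≤ 1) ∧ 0 < D ∧
            (∀ x y, |φ' x - φ' y| ≤ D * dist x y) ∧ (∀ x, |φ x - φ' x| ≤ η) ∧
            ∀ (p τ : ℝ), 0 < τ → ∀ (N : ℕ) (Φ : Flow σ N),
              ∫⁻ z, ENNReal.ofReal (Real.exp (p * (obsA θ u₀ φ g τ Φ z - obsA θ u₀ φ' g τ Φ z)))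
                  ∂(gibbs σ a θ u₀ N Φ) ≤
                ENNReal.ofReal (Real.exp ((N + 1) * ((|p| * η * b) ^ 2 * Real.exp (|p| * η * b) / 2))) := by
  sorry

/-- **S3 · the clamped binned collision payload sum has vanishing window pressure** (the Dynkin /
corrector-balance step of the line: on a good orbit `X̃ₘ = ∑ₙ Ỹₙ` is, up to the deterministic binning
error `≤ (N+1)(K+1)·8cℓ(δφ(b+δ₀)+2δ₀)`, the sum over particles of the jumps of `Wᵢ = cℓ φ'(xᵢ)ψ₀(wᵢ)`
at their first `K+1` collisions of the window, which telescopes (Abel summation along the enumerated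
collisions of `i`; `ψ₀(wᵢ)` is constant on free flights) into a boundary term `≤ 2cℓb` plus a
streaming term `≤ cℓbD ∫₀ʰ |vᵢ| ds` (φ' is `D`-Lipschitz); the window-averaged total speed has
Gaussian exponential moments under the invariant `G_N` by Jensen in time, and `ℓ → 0`). -/
theorem stub_clampedJumpPressure :
    ∀ (a θ : ℝ) (u₀ : V3), 0 < a → 0 < θ → ∀ σ : ℝ, 0 < σ → σ ≤ 1 / 2 →
      ∀ (p c b D k δ : ℝ), 0 < c → 0 < b → 0 < D → 0 < k → 0 < δ →
        ∃ r₀ : ℝ, 0 < r₀ ∧ ∀ (δφ δ₀ : ℝ), 0 < δφ → δφ ≤ r₀ → 0 < δ₀ → δ₀ ≤ r₀ →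
          ∃ τ₀ : ℝ, 0 < τ₀ ∧ ∀ τ : ℝ, τ₀ ≤ τ → ∃ N₀ : ℕ, ∀ N : ℕ, N₀ ≤ N → ∀ Φ : Flow σ N,
            ∀ (φ' : T3 → ℝ) (ψ₀ : V3 → ℝ), Continuous φ' → (∀ x, |φ' x| ≤ 1) →
              (∀ x y, |φ' x - φ' y| ≤ D * dist x y) → Continuous ψ₀ → (∀ v, |ψ₀ v| ≤ b) →
              AEMeasurable (procX θ u₀ φ' ψ₀ c b ⌈k * τ⌉₊ τ δφ δ₀ Φ (horizon N ⌈k * τ⌉₊))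
                  (gibbs σ a θ u₀ N Φ) ∧
              ∫⁻ z, ENNReal.ofReal (Real.exp (p * ((window τ N)⁻¹ *
                  procX θ u₀ φ' ψ₀ c b ⌈k * τ⌉₊ τ δφ δ₀ Φ (horizon N ⌈k * τ⌉₊) z)))
                  ∂(gibbs σ a θ u₀ N Φ) ≤
                ENNReal.ofReal (Real.exp (δ * (N + 1))) := by
  sorry

/-- **S4 · few busy particles** (LD pricing of the per-particle clamp; the lesson of the refuted
ex-crux TwoClocks.EquilibriumCollisionalWindowLD, stmt-14441: exponential moments of COLLISION COUNTS
are destroyed by dense blobs at logarithmic free-volume cost, but here the payload is `lam` per busy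
PARTICLE, however many collisions it has, and a particle with more than `⌈kτ⌉` collisions in the
window costs `≳ min(log(k/c₁) - 1, c₁τ·I(k/c₁))` in entropy, `c₁ = c₁(σ,a,θ)` the collision rate). -/
theorem stub_fewBusyParticles :
    ∀ (a θ : ℝ) (u₀ : V3), 0 < a → 0 < θ → ∀ σ : ℝ, 0 < σ → σ ≤ 1 / 2 →
      ∀ (lam δ : ℝ), 0 < lam → 0 < δ →
        ∃ k₀ : ℝ, 0 < k₀ ∧ ∀ k : ℝ, k₀ ≤ k → ∃ τ₀ : ℝ, 0 < τ₀ ∧ ∀ τ : ℝ, τ₀ ≤ τ →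
          ∃ N₀ : ℕ, ∀ N : ℕ, N₀ ≤ N → ∀ Φ : Flow σ N,
            AEMeasurable (fun z => (busyCount Φ ⌈k * τ⌉₊ (window τ N) z : ℝ)) (gibbs σ a θ u₀ N Φ) ∧
            ∫⁻ z, ENNReal.ofReal (Real.exp (lam * busyCount Φ ⌈k * τ⌉₊ (window τ N) z))
                ∂(gibbs σ a θ u₀ N Φ) ≤ ENNReal.ofReal (Real.exp (δ * (N + 1))) := by
  sorry

/-- **S5 · Azuma–Hoeffding for Doob martingale parts** (generic): the martingale part of an adapted
real process started at `0` with increments bounded by `R` has `E e^{t Mₙ} ≤ e^{2 n R² t²}`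
(martingale differences lie in conditional intervals of length `≤ 4R`; conditional Hoeffding lemma via
`condExpKernel` + `hasSubgaussianMGF_of_mem_Icc_of_integral_eq_zero`, then
`HasSubgaussianMGF.sum_of_hasCondSubgaussianMGF`). Applied to `X̃` along the coarse collision
filtration with `n = (N+1)(K+1)` increments of size `R = 8cℓ(b+δ₀)`: rate `1/n_c`, uniform in `N`. -/
theorem stub_azumaHoeffding {Ω : Type*} {m0 : MeasurableSpace Ω} (μ : Measure Ω)
    [IsProbabilityMeasure μ] (ℱ : Filtration ℕ m0) (f : ℕ → Ω → ℝ) (R : ℝ) (hR : 0 ≤ R)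
    (hf : StronglyAdapted ℱ f) (h0 : ∀ ω, f 0 ω = 0)
    (hbdd : ∀ᵐ ω ∂μ, ∀ i, |f (i + 1) ω - f i ω| ≤ R) (n : ℕ) (t : ℝ) :
    ∫⁻ ω, ENNReal.ofReal (Real.exp (t * martingalePart f ℱ μ n ω)) ∂μ ≤
      ENNReal.ofReal (Real.exp (2 * n * R ^ 2 * t ^ 2)) := by
  sorry

/-- **S6 · THE BET (C⁺) · the predictable compensator defect has vanishing window pressure below an
absolute amplitude**: for the Chapman–Enskog corrector `ψ = cℓψ₀`, `Lψ₀ = g` (the normalisation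
`c = c(σ,a,θ)` makes the one-body Hájek projection of the compensator of the clamped payloads equal
to `h·B` — booking factor 2 repaired, triage (A)), along SOME filtration of the coarse causal class
(discrete marks: no pinning, triage (B)), the defect `R = C - hB` — a doubly-centred partner
U-statistic + density–velocity cross terms + the conditional-vs-annealed encounter-rate defect + ring
bias — satisfies `E_G e^{p R/h} ≤ e^{δ(N+1)}` for `|p|·b ≤ s₀`. The threshold is NECESSARY
(`Disproof.kineticFluxLdDecay_false_allAmplitudes`: invariant Gibbs drift tilts bias the predictable
intensity at second order, coefficient ∝ amplitude). One-sided statement (conditional expectations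
given the causal coarse past): the currency of BodineauEtAl2019 Thm 2.1 / Denlinger2018 / 13478. -/
theorem stub_compensatorDefect :
    ∀ (a θ : ℝ) (u₀ : V3), 0 < a → 0 < θ → ∃ σ₀ : ℝ, 0 < σ₀ ∧ ∀ σ : ℝ, 0 < σ → σ < σ₀ →
      ∃ c : ℝ, 0 < c ∧ ∃ s₀ : ℝ, 0 < s₀ ∧
        ∀ (p b D k : ℝ), 0 < b → 0 < D → 0 < k → |p| * b ≤ s₀ →
          ∀ (g ψ₀ : V3 → ℝ), Continuous g → Continuous ψ₀ → (∀ v, |g v| ≤ b) →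
            (∀ v, |ψ₀ v| ≤ b) →
            (∀ (c₀ c₂ : ℝ) (e : V3),
              ∫ v, g v * (c₀ + inner ℝ e v + c₂ * ‖v‖ ^ 2) ∂(stdGaussian V3) = 0) →
            hardSphereLinearizedOp ψ₀ = g →
            ∀ φ' : T3 → ℝ, Continuous φ' → (∀ x, |φ' x| ≤ 1) →
              (∀ x y, |φ' x - φ' y| ≤ D * dist x y) →
              ∀ δ : ℝ, 0 < δ → ∃ r₀ : ℝ, 0 < r₀ ∧
                ∀ (δφ δ₀ : ℝ), 0 < δφ → δφ ≤ r₀ → 0 < δ₀ → δ₀ ≤ r₀ →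
                ∀ (δt δx δv : ℝ), 0 < δt → 0 < δx → 0 < δv →
                  ∃ τ₀ : ℝ, 0 < τ₀ ∧ ∀ τ : ℝ, τ₀ ≤ τ → ∃ N₀ : ℕ, ∀ N : ℕ, N₀ ≤ N →
                    ∀ Φ : Flow σ N,
                    ∃ ℱ : Filtration ℕ (inferInstance : MeasurableSpace (Phase N)),
                      StronglyAdapted ℱ (procX θ u₀ φ' ψ₀ c b ⌈k * τ⌉₊ τ δφ δ₀ Φ) ∧
                      (∀ n, (ℱ n : MeasurableSpace (Phase N)) ≤
                        causalSigma θ u₀ φ' ψ₀ ⌈k * τ⌉₊ τ δt δx δv δφ δ₀ Φ n) ∧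
                      ∫⁻ z, ENNReal.ofReal (Real.exp (p * ((window τ N)⁻¹ *
                          defect a θ u₀ φ' ψ₀ g c b ⌈k * τ⌉₊ τ δφ δ₀ Φ ℱ z)))
                          ∂(gibbs σ a θ u₀ N Φ) ≤
                        ENNReal.ofReal (Real.exp (δ * (N + 1))) := by
  sorry

/-! ## § 6 Composition: the stubs imply the crux (kernel-checked; no `sorry` from here on) -/

section Composition

/-- Five-term exponential convexity: `exp(∑ xⱼ) ≤ 5⁻¹ ∑ exp(5 xⱼ)`. -/
theorem exp_sum_five_le (x : Fin 5 → ℝ) :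
    Real.exp (∑ i, x i) ≤ 5⁻¹ * ∑ i, Real.exp (5 * x i) := by
  have h := (convexOn_exp).map_sum_le (t := (Finset.univ : Finset (Fin 5)))
    (w := fun _ => (5⁻¹ : ℝ)) (p := fun i => 5 * x i) (fun _ _ => by positivity)
    (by norm_num [Finset.sum_const, Finset.card_univ]) (fun _ _ => Set.mem_univ _)
  simp only [smul_eq_mul] at h
  have e1 : ∑ i : Fin 5, (5⁻¹ : ℝ) * (5 * x i) = ∑ i, x i :=
    Finset.sum_congr rfl fun i _ => by ring
  rw [e1, ← Finset.mul_sum] at h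
  exact h

theorem exp_add_five_le (x₁ x₂ x₃ x₄ x₅ : ℝ) :
    Real.exp (x₁ + x₂ + x₃ + x₄ + x₅) ≤
      5⁻¹ * (Real.exp (5 * x₁) + Real.exp (5 * x₂) + Real.exp (5 * x₃) + Real.exp (5 * x₄) +
        Real.exp (5 * x₅)) := by
  have h := exp_sum_five_le ![x₁, x₂, x₃, x₄, x₅]
  simp only [Fin.sum_univ_five] at h
  simpa [add_assoc] using h

theorem ell_pos (N : ℕ) : 0 < ell N := Real.rpow_pos_of_pos (by positivity) _

theorem window_eq (τ : ℝ) (N : ℕ) : window τ N = τ * ell N := rfl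

theorem window_pos {τ : ℝ} (hτ : 0 < τ) (N : ℕ) : 0 < window τ N := mul_pos hτ (ell_pos N)

/-! ### Orbits of good points: measurability in time and integrability of bounded observables -/

theorem continuous_sv (θ : ℝ) (u₀ : V3) : Continuous (sv θ u₀) := by
  show Continuous fun v : V3 => (Real.sqrt θ)⁻¹ • (v - u₀)
  exact ((continuous_id (X := V3)).sub continuous_const).const_smul ((Real.sqrt θ)⁻¹)

theorem measurable_orbit {σ : ℝ} {N : ℕ} (Φ : Flow σ N) {z : Phase N} (hz : z ∈ Φ.good) :
    Measurable fun s : ℝ => Φ.flow s z := by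
  have h := HardSphereFlow.measurable_flow_prod_torus Φ
  have h2 : Measurable fun s : ℝ => ((⟨z, hz⟩ : Φ.good), s) := measurable_const.prodMk measurable_id
  exact h.comp h2

theorem measurable_obsF {θ : ℝ} {u₀ : V3} {φ : T3 → ℝ} {g : V3 → ℝ} (hφ : Continuous φ)
    (hg : Continuous g) {N : ℕ} :
    Measurable fun z : Phase N => ∑ i, φ (z i).1 * g (sv θ u₀ (z i).2) := by
  refine Finset.measurable_sum _ fun i _ => ?_
  exact (hφ.measurable.comp (measurable_pi_apply i).fst).mul
    (hg.measurable.comp ((continuous_sv θ u₀).measurable.comp (measurable_pi_apply i).snd))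

theorem intervalIntegrable_orbit {σ θ : ℝ} {u₀ : V3} {N : ℕ} (Φ : Flow σ N) {z : Phase N}
    (hz : z ∈ Φ.good) {φ : T3 → ℝ} {g : V3 → ℝ} (hφ : Continuous φ) (hg : Continuous g)
    {C : ℝ} (hφ1 : ∀ x, |φ x| ≤ 1) (hgC : ∀ v, |g v| ≤ C) (i : Fin (N + 1)) (s t : ℝ) :
    IntervalIntegrable (fun r => φ (Φ.flow r z i).1 * g (sv θ u₀ (Φ.flow r z i).2)) volume s t := by
  have ho := measurable_orbit Φ hz
  have hm : Measurable fun r => φ (Φ.flow r z i).1 * g (sv θ u₀ (Φ.flow r z i).2) :=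
    (hφ.measurable.comp ((measurable_pi_apply i).comp ho).fst).mul
      (hg.measurable.comp ((continuous_sv θ u₀).measurable.comp ((measurable_pi_apply i).comp ho).snd))
  rw [intervalIntegrable_iff]
  refine IntegrableOn.of_bound (by simp [Real.volume_uIoc]) hm.aestronglyMeasurable C
    (ae_of_all _ fun r => ?_)
  rw [Real.norm_eq_abs, abs_mul]
  calc |φ (Φ.flow r z i).1| * |g (sv θ u₀ (Φ.flow r z i).2)| ≤ 1 * C :=
        mul_le_mul (hφ1 _) (hgC _) (abs_nonneg _) zero_le_one
    _ = C := one_mul C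

/-! ### The post-clamp remainder is carried by the busy particles -/

theorem clampRem_le {σ θ : ℝ} {u₀ : V3} {N : ℕ} (Φ : Flow σ N) {z : Phase N} (hz : z ∈ Φ.good)
    {φ' : T3 → ℝ} {g : V3 → ℝ} (hφ' : Continuous φ') (hg : Continuous g) (hφ'1 : ∀ x, |φ' x| ≤ 1)
    {κ : ℝ} (hgκ : ∀ v, |g v| ≤ κ) (hκ : 0 ≤ κ) {τ : ℝ} (hτ : 0 < τ) (K : ℕ) :
    obsA θ u₀ φ' g τ Φ z - obsB θ u₀ φ' g τ K Φ z ≤ 2 * κ * busyCount Φ K (window τ N) z := by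
  classical
  set h := window τ N with hh
  have hpos : 0 < h := window_pos hτ N
  set f : Fin (N + 1) → ℝ → ℝ := fun i r => φ' (Φ.flow r z i).1 * g (sv θ u₀ (Φ.flow r z i).2)
    with hf
  have hfb : ∀ i r, |f i r| ≤ κ := fun i r => by
    simp only [hf, abs_mul]
    calc |φ' (Φ.flow r z i).1| * |g (sv θ u₀ (Φ.flow r z i).2)| ≤ 1 * κ :=
          mul_le_mul (hφ'1 _) (hgκ _) (abs_nonneg _) zero_le_one
      _ = κ := one_mul κ
  have hswap : ∫ s in (0 : ℝ)..h, ∑ i, f i s = ∑ i, ∫ s in (0 : ℝ)..h, f i s :=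
    intervalIntegral.integral_finsetSum fun i _ =>
      intervalIntegrable_orbit Φ hz hφ' hg hφ'1 hgκ i 0 h
  have hterm : ∀ i, (∫ s in (0 : ℝ)..h, f i s) - ∫ s in (0 : ℝ)..stopTime Φ K h i z, f i s ≤
      if busy Φ K h i z = true then 2 * κ * h else 0 := by
    intro i
    unfold stopTime
    split_ifs with hB
    · set T : ℝ := max 0 (min h (Φ.nthCollisionTimeOf i K z)) with hT
      have hT0 : 0 ≤ T := le_max_left _ _
      have hTh : T ≤ h := max_le hpos.le (min_le_left _ _)
      have h1 : ‖∫ s in (0 : ℝ)..h, f i s‖ ≤ κ * |h - 0| :=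
        intervalIntegral.norm_integral_le_of_norm_le_const fun r _ => by
          rw [Real.norm_eq_abs]; exact hfb i r
      have h2 : ‖∫ s in (0 : ℝ)..T, f i s‖ ≤ κ * |T - 0| :=
        intervalIntegral.norm_integral_le_of_norm_le_const fun r _ => by
          rw [Real.norm_eq_abs]; exact hfb i r
      rw [Real.norm_eq_abs, sub_zero, abs_of_pos hpos] at h1
      rw [Real.norm_eq_abs, sub_zero, abs_of_nonneg hT0] at h2
      have h3 : κ * T ≤ κ * h := mul_le_mul_of_nonneg_left hTh hκ
      have := abs_le.1 h1
      have := abs_le.1 h2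
      linarith
    · simp
  have hA : obsA θ u₀ φ' g τ Φ z = h⁻¹ * ∑ i, ∫ s in (0 : ℝ)..h, f i s := by
    rw [← hswap]
    rfl
  have hBdef : obsB θ u₀ φ' g τ K Φ z = h⁻¹ * ∑ i, ∫ s in (0 : ℝ)..stopTime Φ K h i z, f i s :=
    rfl
  rw [hA, hBdef, ← mul_sub, ← Finset.sum_sub_distrib]
  calc h⁻¹ * ∑ i, ((∫ s in (0 : ℝ)..h, f i s) - ∫ s in (0 : ℝ)..stopTime Φ K h i z, f i s)
      ≤ h⁻¹ * ∑ i, (if busy Φ K h i z = true then 2 * κ * h else 0) :=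
        mul_le_mul_of_nonneg_left (Finset.sum_le_sum fun i _ => hterm i) (inv_nonneg.2 hpos.le)
    _ = 2 * κ * busyCount Φ K h z := by
        rw [Finset.sum_ite, Finset.sum_const_zero, add_zero, Finset.sum_const, nsmul_eq_mul]
        unfold busyCount
        field_simp

/-! ### Measurability of the crux functional and of the compensator -/

theorem gibbs_compl_good {σ a θ : ℝ} {u₀ : V3} {N : ℕ} (Φ : Flow σ N) :
    gibbs σ a θ u₀ N Φ Φ.goodᶜ = 0 :=
  ae_iff.1 (ae_mem_good_localGibbsLaw σ (fun _ => a) (fun _ => u₀) (fun _ => θ) N Φ)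

theorem aemeasurable_obsA {σ a θ : ℝ} {u₀ : V3} {φ : T3 → ℝ} {g : V3 → ℝ} (hφ : Continuous φ)
    (hg : Continuous g) (τ : ℝ) {N : ℕ} (Φ : Flow σ N) :
    AEMeasurable (obsA θ u₀ φ g τ Φ) (gibbs σ a θ u₀ N Φ) := by
  unfold obsA
  exact (HardSphereFlow.aemeasurable_intervalIntegral_comp_flow_torus Φ (measurable_obsF hφ hg) 0
    (window τ N) (gibbs_compl_good Φ)).const_mul _

theorem measurable_comp (a θ : ℝ) (u₀ : V3) (φ' : T3 → ℝ) (ψ₀ : V3 → ℝ) (c b : ℝ) (K : ℕ)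
    (τ δφ δ₀ : ℝ) {σ : ℝ} {N : ℕ} (Φ : Flow σ N)
    (ℱ : Filtration ℕ (inferInstance : MeasurableSpace (Phase N))) :
    Measurable (comp a θ u₀ φ' ψ₀ c b K τ δφ δ₀ Φ ℱ) := by
  have h := (stronglyAdapted_predictablePart' (f := procX θ u₀ φ' ψ₀ c b K τ δφ δ₀ Φ) (ℱ := ℱ)
    (μ := gibbs σ a θ u₀ N Φ)) (horizon N K)
  exact (h.mono (ℱ.le _)).measurable

/-! ### The five-way split -/

variable {σ a θ : ℝ} {u₀ : V3} {N : ℕ}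

/-- The assembly at fixed `N`, `Φ`: the exact identity
`A_φ = (A_φ - A_φ') + (A_φ' - B) + h⁻¹X̃ - h⁻¹M - h⁻¹R`, the busy-particle bound on `A_φ' - B`,
exponential convexity with five terms at tilt `5`, and the five pressure bounds. -/
theorem assemble (Φ : Flow σ N) {φ φ' : T3 → ℝ} {g ψ₀ : V3 → ℝ} {c b κ δ τ k δφ δ₀ : ℝ}
    (ℱ : Filtration ℕ (inferInstance : MeasurableSpace (Phase N)))
    (hδ : 0 < δ)
    (hDoob : ∀ z : Phase N, obsB θ u₀ φ' g τ ⌈k * τ⌉₊ Φ z =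
      (window τ N)⁻¹ * procX θ u₀ φ' ψ₀ c b ⌈k * τ⌉₊ τ δφ δ₀ Φ (horizon N ⌈k * τ⌉₊) z -
      (window τ N)⁻¹ * innov a θ u₀ φ' ψ₀ c b ⌈k * τ⌉₊ τ δφ δ₀ Φ ℱ z -
      (window τ N)⁻¹ * defect a θ u₀ φ' ψ₀ g c b ⌈k * τ⌉₊ τ δφ δ₀ Φ ℱ z)
    (hClamp : ∀ z ∈ Φ.good, obsA θ u₀ φ' g τ Φ z - obsB θ u₀ φ' g τ ⌈k * τ⌉₊ Φ z ≤
      2 * κ * busyCount Φ ⌈k * τ⌉₊ (window τ N) z)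
    (hEm : AEMeasurable (fun z => obsA θ u₀ φ g τ Φ z - obsA θ u₀ φ' g τ Φ z) (gibbs σ a θ u₀ N Φ))
    (hE : ∫⁻ z, ENNReal.ofReal (Real.exp (5 * (obsA θ u₀ φ g τ Φ z - obsA θ u₀ φ' g τ Φ z)))
        ∂(gibbs σ a θ u₀ N Φ) ≤ ENNReal.ofReal (Real.exp (δ / 5 * (N + 1))))
    (hBm : AEMeasurable (fun z => (busyCount Φ ⌈k * τ⌉₊ (window τ N) z : ℝ)) (gibbs σ a θ u₀ N Φ))
    (hBusy : ∫⁻ z, ENNReal.ofReal (Real.exp (10 * κ * busyCount Φ ⌈k * τ⌉₊ (window τ N) z))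
        ∂(gibbs σ a θ u₀ N Φ) ≤ ENNReal.ofReal (Real.exp (δ / 5 * (N + 1))))
    (hXm : AEMeasurable (procX θ u₀ φ' ψ₀ c b ⌈k * τ⌉₊ τ δφ δ₀ Φ (horizon N ⌈k * τ⌉₊))
        (gibbs σ a θ u₀ N Φ))
    (hX : ∫⁻ z, ENNReal.ofReal (Real.exp (5 * ((window τ N)⁻¹ *
        procX θ u₀ φ' ψ₀ c b ⌈k * τ⌉₊ τ δφ δ₀ Φ (horizon N ⌈k * τ⌉₊) z))) ∂(gibbs σ a θ u₀ N Φ) ≤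
        ENNReal.ofReal (Real.exp (δ / 5 * (N + 1))))
    (hM : ∫⁻ z, ENNReal.ofReal (Real.exp (-(5 * (window τ N)⁻¹) *
        innov a θ u₀ φ' ψ₀ c b ⌈k * τ⌉₊ τ δφ δ₀ Φ ℱ z)) ∂(gibbs σ a θ u₀ N Φ) ≤
        ENNReal.ofReal (Real.exp (δ / 5 * (N + 1))))
    (hR : ∫⁻ z, ENNReal.ofReal (Real.exp (-5 * ((window τ N)⁻¹ *
        defect a θ u₀ φ' ψ₀ g c b ⌈k * τ⌉₊ τ δφ δ₀ Φ ℱ z))) ∂(gibbs σ a θ u₀ N Φ) ≤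
        ENNReal.ofReal (Real.exp (δ / 5 * (N + 1)))) :
    ∫⁻ z, ENNReal.ofReal (Real.exp (obsA θ u₀ φ g τ Φ z)) ∂(gibbs σ a θ u₀ N Φ) ≤
      ENNReal.ofReal (Real.exp (δ * (N + 1))) := by
  set G := gibbs σ a θ u₀ N Φ with hG
  set K := ⌈k * τ⌉₊ with hK
  set hw := window τ N with hhw
  -- the five integrands
  set F₁ : Phase N → ℝ≥0∞ := fun z =>
    ENNReal.ofReal (Real.exp (5 * (obsA θ u₀ φ g τ Φ z - obsA θ u₀ φ' g τ Φ z))) with hF₁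
  set F₂ : Phase N → ℝ≥0∞ := fun z =>
    ENNReal.ofReal (Real.exp (10 * κ * busyCount Φ K hw z)) with hF₂
  set F₃ : Phase N → ℝ≥0∞ := fun z =>
    ENNReal.ofReal (Real.exp (5 * (hw⁻¹ * procX θ u₀ φ' ψ₀ c b K τ δφ δ₀ Φ (horizon N K) z)))
    with hF₃
  set F₄ : Phase N → ℝ≥0∞ := fun z =>
    ENNReal.ofReal (Real.exp (-(5 * hw⁻¹) * innov a θ u₀ φ' ψ₀ c b K τ δφ δ₀ Φ ℱ z)) with hF₄
  set F₅ : Phase N → ℝ≥0∞ := fun z =>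
    ENNReal.ofReal (Real.exp (-5 * (hw⁻¹ * defect a θ u₀ φ' ψ₀ g c b K τ δφ δ₀ Φ ℱ z))) with hF₅
  -- pointwise bound, almost everywhere (on the good set)
  have hpt : ∀ᵐ z ∂G, ENNReal.ofReal (Real.exp (obsA θ u₀ φ g τ Φ z)) ≤
      ENNReal.ofReal 5⁻¹ * (F₁ z + F₂ z + F₃ z + F₄ z + F₅ z) := by
    filter_upwards [ae_mem_good_localGibbsLaw σ (fun _ => a) (fun _ => u₀) (fun _ => θ) N Φ]
      with z hz
    have hid : obsA θ u₀ φ g τ Φ z =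
        (obsA θ u₀ φ g τ Φ z - obsA θ u₀ φ' g τ Φ z) +
        (obsA θ u₀ φ' g τ Φ z - obsB θ u₀ φ' g τ K Φ z) +
        hw⁻¹ * procX θ u₀ φ' ψ₀ c b K τ δφ δ₀ Φ (horizon N K) z +
        (-(5 * hw⁻¹) * innov a θ u₀ φ' ψ₀ c b K τ δφ δ₀ Φ ℱ z) / 5 +
        (-5 * (hw⁻¹ * defect a θ u₀ φ' ψ₀ g c b K τ δφ δ₀ Φ ℱ z)) / 5 := by
      have hB := hDoob z
      rw [hB]
      ring
    have hCl := hClamp z hz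
    have hreal : Real.exp (obsA θ u₀ φ g τ Φ z) ≤
        5⁻¹ * (Real.exp (5 * (obsA θ u₀ φ g τ Φ z - obsA θ u₀ φ' g τ Φ z)) +
          Real.exp (10 * κ * busyCount Φ K hw z) +
          Real.exp (5 * (hw⁻¹ * procX θ u₀ φ' ψ₀ c b K τ δφ δ₀ Φ (horizon N K) z)) +
          Real.exp (-(5 * hw⁻¹) * innov a θ u₀ φ' ψ₀ c b K τ δφ δ₀ Φ ℱ z) +
          Real.exp (-5 * (hw⁻¹ * defect a θ u₀ φ' ψ₀ g c b K τ δφ δ₀ Φ ℱ z))) := by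
      have step : Real.exp (obsA θ u₀ φ g τ Φ z) ≤
          Real.exp ((obsA θ u₀ φ g τ Φ z - obsA θ u₀ φ' g τ Φ z) +
            (2 * κ * busyCount Φ K hw z) +
            hw⁻¹ * procX θ u₀ φ' ψ₀ c b K τ δφ δ₀ Φ (horizon N K) z +
            (-(5 * hw⁻¹) * innov a θ u₀ φ' ψ₀ c b K τ δφ δ₀ Φ ℱ z) / 5 +
            (-5 * (hw⁻¹ * defect a θ u₀ φ' ψ₀ g c b K τ δφ δ₀ Φ ℱ z)) / 5) := by
        rw [Real.exp_le_exp]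
        rw [hid]
        linarith
      refine step.trans ?_
      refine (exp_add_five_le _ _ _ _ _).trans (le_of_eq ?_)
      congr 2
      · ring_nf
      · ring_nf
    have hnn : ∀ x : ℝ, 0 ≤ Real.exp x := fun x => (Real.exp_pos x).le
    calc ENNReal.ofReal (Real.exp (obsA θ u₀ φ g τ Φ z))
        ≤ ENNReal.ofReal (5⁻¹ * (Real.exp (5 * (obsA θ u₀ φ g τ Φ z - obsA θ u₀ φ' g τ Φ z)) +
          Real.exp (10 * κ * busyCount Φ K hw z) +
          Real.exp (5 * (hw⁻¹ * procX θ u₀ φ' ψ₀ c b K τ δφ δ₀ Φ (horizon N K) z)) +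
          Real.exp (-(5 * hw⁻¹) * innov a θ u₀ φ' ψ₀ c b K τ δφ δ₀ Φ ℱ z) +
          Real.exp (-5 * (hw⁻¹ * defect a θ u₀ φ' ψ₀ g c b K τ δφ δ₀ Φ ℱ z)))) :=
          ENNReal.ofReal_le_ofReal hreal
      _ = ENNReal.ofReal 5⁻¹ * (F₁ z + F₂ z + F₃ z + F₄ z + F₅ z) := by
          simp only [hF₁, hF₂, hF₃, hF₄, hF₅]
          rw [ENNReal.ofReal_mul (by norm_num), ENNReal.ofReal_add (by positivity) (hnn _),
            ENNReal.ofReal_add (by positivity) (hnn _), ENNReal.ofReal_add (by positivity) (hnn _),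
            ENNReal.ofReal_add (hnn _) (hnn _)]
  -- measurability of the first four integrands
  have hm₁ : AEMeasurable F₁ G :=
    ENNReal.measurable_ofReal.comp_aemeasurable (Real.measurable_exp.comp_aemeasurable (hEm.const_mul 5))
  have hm₂ : AEMeasurable F₂ G :=
    ENNReal.measurable_ofReal.comp_aemeasurable (Real.measurable_exp.comp_aemeasurable
      (hBm.const_mul (10 * κ)))
  have hm₃ : AEMeasurable F₃ G :=
    ENNReal.measurable_ofReal.comp_aemeasurable (Real.measurable_exp.comp_aemeasurable
      ((hXm.const_mul hw⁻¹).const_mul 5))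
  have hMm : AEMeasurable (innov a θ u₀ φ' ψ₀ c b K τ δφ δ₀ Φ ℱ) G := by
    have h1 := (measurable_comp a θ u₀ φ' ψ₀ c b K τ δφ δ₀ Φ ℱ).aemeasurable (μ := G)
    have h2 : innov a θ u₀ φ' ψ₀ c b K τ δφ δ₀ Φ ℱ = fun z =>
        procX θ u₀ φ' ψ₀ c b K τ δφ δ₀ Φ (horizon N K) z - comp a θ u₀ φ' ψ₀ c b K τ δφ δ₀ Φ ℱ z := by
      funext z; rfl
    rw [h2]
    exact hXm.sub h1
  have hm₄ : AEMeasurable F₄ G :=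
    ENNReal.measurable_ofReal.comp_aemeasurable (Real.measurable_exp.comp_aemeasurable
      (hMm.const_mul _))
  have hm₁₂ : AEMeasurable (fun z => F₁ z + F₂ z) G := hm₁.add hm₂
  have hm₁₂₃ : AEMeasurable (fun z => F₁ z + F₂ z + F₃ z) G := hm₁₂.add hm₃
  have hm₁₂₃₄ : AEMeasurable (fun z => F₁ z + F₂ z + F₃ z + F₄ z) G := hm₁₂₃.add hm₄
  -- integrate
  have hsplit : ∫⁻ z, (F₁ z + F₂ z + F₃ z + F₄ z + F₅ z) ∂G =
      ∫⁻ z, F₁ z ∂G + ∫⁻ z, F₂ z ∂G + ∫⁻ z, F₃ z ∂G + ∫⁻ z, F₄ z ∂G + ∫⁻ z, F₅ z ∂G := by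
    rw [lintegral_add_left' hm₁₂₃₄, lintegral_add_left' hm₁₂₃, lintegral_add_left' hm₁₂,
      lintegral_add_left' hm₁]
  set β : ℝ≥0∞ := ENNReal.ofReal (Real.exp (δ / 5 * (N + 1))) with hβ
  have h5 : ∫⁻ z, (F₁ z + F₂ z + F₃ z + F₄ z + F₅ z) ∂G ≤ 5 * β := by
    rw [hsplit]
    calc ∫⁻ z, F₁ z ∂G + ∫⁻ z, F₂ z ∂G + ∫⁻ z, F₃ z ∂G + ∫⁻ z, F₄ z ∂G + ∫⁻ z, F₅ z ∂G
        ≤ β + β + β + β + β := by gcongr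
      _ = 5 * β := by ring
  calc ∫⁻ z, ENNReal.ofReal (Real.exp (obsA θ u₀ φ g τ Φ z)) ∂G
      ≤ ∫⁻ z, ENNReal.ofReal 5⁻¹ * (F₁ z + F₂ z + F₃ z + F₄ z + F₅ z) ∂G := lintegral_mono_ae hpt
    _ = ENNReal.ofReal 5⁻¹ * ∫⁻ z, (F₁ z + F₂ z + F₃ z + F₄ z + F₅ z) ∂G :=
        lintegral_const_mul' _ _ ENNReal.ofReal_ne_top
    _ ≤ ENNReal.ofReal 5⁻¹ * (5 * β) := by gcongr
    _ = β := by
        rw [← mul_assoc, ← ENNReal.ofReal_ofNat 5, ← ENNReal.ofReal_mul (by norm_num)]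
        norm_num
    _ ≤ ENNReal.ofReal (Real.exp (δ * (N + 1))) := by
        apply ENNReal.ofReal_le_ofReal
        apply Real.exp_le_exp.2
        have : (0 : ℝ) ≤ (N : ℝ) + 1 := by positivity
        nlinarith

/-! ### Threading the thresholds (arithmetic kept in small lemmas) -/

theorem azuma_exponent_eq (N K : ℕ) (c b r τ : ℝ) (hτ : τ ≠ 0) :
    2 * ((horizon N K : ℕ) : ℝ) * payloadCap c b r N ^ 2 * (-(5 * (window τ N)⁻¹)) ^ 2 =
      ((N : ℝ) + 1) * (((K : ℝ) + 1) * (3200 * c ^ 2 * (b + r) ^ 2) / τ ^ 2) := by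
  have hℓ : ell N ≠ 0 := (ell_pos N).ne'
  have hm : ((horizon N K : ℕ) : ℝ) = ((N : ℝ) + 1) * ((K : ℝ) + 1) := by simp [horizon]
  rw [hm, window_eq]
  simp only [payloadCap]
  field_simp
  ring

theorem azuma_exponent_le {K : ℕ} {k τ Q δ : ℝ} (hk : 0 < k) (hδ : 0 < δ) (hQ : 0 ≤ Q)
    (hK : K = ⌈k * τ⌉₊) (hτtwo : 2 ≤ τ) (hτQ : 5 * Q * (k + 1) / (δ / 5) ≤ τ) :
    ((K : ℝ) + 1) * Q / τ ^ 2 ≤ δ / 5 := by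
  have hτpos : 0 < τ := two_pos.trans_le hτtwo
  have hKτ : (K : ℝ) + 1 ≤ (k + 1) * τ := by
    have h1 : (K : ℝ) < k * τ + 1 := by
      rw [hK]
      exact Nat.ceil_lt_add_one (by positivity)
    nlinarith
  have h1 : ((K : ℝ) + 1) * Q / τ ^ 2 ≤ (k + 1) * τ * Q / τ ^ 2 := by gcongr
  have h2 : (k + 1) * τ * Q / τ ^ 2 = (k + 1) * Q / τ := by
    field_simp
  have h3 : (k + 1) * Q / τ ≤ δ / 5 := by
    rw [div_le_iff₀ hτpos]
    have h4 := (div_le_iff₀ (by positivity : (0 : ℝ) < δ / 5)).1 hτQ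
    nlinarith
  linarith

theorem moll_exponent_le {x δ : ℝ} (hx0 : 0 < x) (hx1 : x ≤ 1) (hxδ : x ≤ 2 * (δ / 5) / 3) :
    x ^ 2 * Real.exp x / 2 ≤ δ / 5 := by
  have hex : Real.exp x ≤ 3 :=
    ((Real.exp_le_exp.2 hx1).trans Real.exp_one_lt_d9.le).trans (by norm_num)
  have hsq : x ^ 2 ≤ x := by nlinarith
  have he0 := (Real.exp_pos x).le
  calc x ^ 2 * Real.exp x / 2 ≤ x * 3 / 2 := by gcongr
    _ ≤ δ / 5 := by linarith

theorem KineticFluxLdDecay_of : KineticFluxLdDecay := by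
  intro a θ u₀ ha hθ
  obtain ⟨C₀, hC₀, hCE⟩ := stub_chapmanEnskogInverse
  obtain ⟨σ₁, hσ₁, hC⟩ := stub_compensatorDefect a θ u₀ ha hθ
  refine ⟨min σ₁ (1 / 2), lt_min hσ₁ (by norm_num), fun σ hσ hσlt => ?_⟩
  have hσ₁' : σ < σ₁ := hσlt.trans_le (min_le_left _ _)
  have hσ2 : σ ≤ 1 / 2 := (hσlt.trans_le (min_le_right _ _)).le
  refine ⟨fun N Φ => isProbabilityMeasure_localGibbsLaw continuous_const continuous_const
      continuous_const (fun _ => ha) (fun _ => hθ) hσ2 N Φ, ?_⟩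
  obtain ⟨c, hc, s₀, hs₀, hC⟩ := hC σ hσ hσ₁'
  -- the amplitude `κ`: `5 · max(1, C₀) · κ = s₀`
  obtain ⟨L, hL⟩ : ∃ L : ℝ, L = max 1 C₀ := ⟨_, rfl⟩
  have hL1 : 1 ≤ L := hL ▸ le_max_left _ _
  have hLC : C₀ ≤ L := hL ▸ le_max_right _ _
  have hLpos : 0 < L := one_pos.trans_le hL1
  obtain ⟨κ, hκ⟩ : ∃ κ : ℝ, κ = s₀ / (5 * L) := ⟨_, rfl⟩
  have hκpos : 0 < κ := by rw [hκ]; positivity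
  refine ⟨κ, hκpos, fun φ g hφc hgc hφ1 hgκ horth δ hδ => ?_⟩
  obtain ⟨b, hb⟩ : ∃ b : ℝ, b = L * κ := ⟨_, rfl⟩
  have hbpos : 0 < b := by rw [hb]; positivity
  have hκb : κ ≤ b := by
    rw [hb]
    have : 1 * κ ≤ L * κ := mul_le_mul_of_nonneg_right hL1 hκpos.le
    linarith
  have h5b : (5 : ℝ) * b = s₀ := by
    rw [hb, hκ]
    field_simp
  -- Chapman–Enskog inverse of `g`
  obtain ⟨ψ₀, hψc, hψb, hLψ⟩ := hCE g κ hgc hgκ horth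
  have hgb : ∀ v, |g v| ≤ b := fun v => (hgκ v).trans hκb
  have hψb' : ∀ v, |ψ₀ v| ≤ b := fun v =>
    (hψb v).trans (hb ▸ mul_le_mul_of_nonneg_right hLC hκpos.le)
  -- centring of `g` (orthogonality to the constants)
  have hg0 : ∫ v, g v ∂(stdGaussian V3) = 0 := by
    have h := horth 1 0 0
    have h' : (fun v => g v * (1 + inner ℝ (0 : V3) v + 0 * ‖v‖ ^ 2)) = g := by
      funext v
      rw [inner_zero_left, zero_mul, add_zero, add_zero, mul_one]
    rwa [h'] at h
  -- Lipschitz regularisation of `φ`, with `x := 5ηκ = min 1 (2(δ/5)/3)`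
  obtain ⟨x, hx⟩ : ∃ x : ℝ, x = min 1 (2 * (δ / 5) / 3) := ⟨_, rfl⟩
  have hxpos : 0 < x := hx ▸ lt_min one_pos (by positivity)
  have hx1 : x ≤ 1 := hx ▸ min_le_left _ _
  have hxδ : x ≤ 2 * (δ / 5) / 3 := hx ▸ min_le_right _ _
  obtain ⟨η, hη⟩ : ∃ η : ℝ, η = x / (5 * κ) := ⟨_, rfl⟩
  have hηpos : 0 < η := by rw [hη]; positivity
  have hηx : 5 * η * κ = x := by
    rw [hη]
    field_simp
  obtain ⟨φ', D, hφ'c, hφ'1, hD, hLip, -, hS2⟩ :=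
    stub_lipschitzRegularisation a θ u₀ ha hθ σ hσ hσ2 φ g κ hφc hgc hφ1 hgκ hg0 η hηpos
  -- few busy particles, payload `10κ` per busy particle
  obtain ⟨k, hk, hS4⟩ := stub_fewBusyParticles a θ u₀ ha hθ σ hσ hσ2 (10 * κ) (δ / 5)
    (by positivity) (by positivity)
  obtain ⟨τ₁, -, hS4⟩ := hS4 k le_rfl
  -- clamped jump pressure at tilt `5`
  obtain ⟨r₁, hr₁, hS3⟩ := stub_clampedJumpPressure a θ u₀ ha hθ σ hσ hσ2 5 c b D k (δ / 5)
    hc hbpos hD hk (by positivity)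
  -- compensator defect at tilt `-5`
  have hp : |(-5 : ℝ)| * b ≤ s₀ := by
    rw [abs_neg, abs_of_pos (by norm_num : (0 : ℝ) < 5), h5b]
  obtain ⟨r₂, hr₂, hS6⟩ := hC (-5) b D k hbpos hD hk hp g ψ₀ hgc hψc hgb hψb' horth hLψ φ' hφ'c
    hφ'1 hLip (δ / 5) (by positivity)
  obtain ⟨r, hr⟩ : ∃ r : ℝ, r = min r₁ r₂ := ⟨_, rfl⟩
  have hrpos : 0 < r := hr ▸ lt_min hr₁ hr₂
  have hrr₁ : r ≤ r₁ := hr ▸ min_le_left _ _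
  have hrr₂ : r ≤ r₂ := hr ▸ min_le_right _ _
  obtain ⟨τ₂, -, hS3⟩ := hS3 r r hrpos hrr₁ hrpos hrr₁
  obtain ⟨τ₃, -, hS6⟩ := hS6 r r hrpos hrr₂ hrpos hrr₂ 1 1 1 one_pos one_pos one_pos
  -- Azuma threshold
  obtain ⟨Q, hQ⟩ : ∃ Q : ℝ, Q = 3200 * c ^ 2 * (b + r) ^ 2 := ⟨_, rfl⟩
  have hQnn : 0 ≤ Q := by rw [hQ]; positivity
  obtain ⟨τ, hτdef⟩ : ∃ τ : ℝ, τ = max (max τ₁ τ₂) (max τ₃ (max 2 (5 * Q * (k + 1) / (δ / 5)))) :=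
    ⟨_, rfl⟩
  have hτ1 : τ₁ ≤ τ := hτdef ▸ (le_max_left _ _).trans (le_max_left _ _)
  have hτ2 : τ₂ ≤ τ := hτdef ▸ (le_max_right _ _).trans (le_max_left _ _)
  have hτ3 : τ₃ ≤ τ := hτdef ▸ (le_max_left _ _).trans (le_max_right _ _)
  have hτtwo : 2 ≤ τ := hτdef ▸ ((le_max_left _ _).trans (le_max_right _ _)).trans (le_max_right _ _)
  have hτQ : 5 * Q * (k + 1) / (δ / 5) ≤ τ :=
    hτdef ▸ ((le_max_right _ _).trans (le_max_right _ _)).trans (le_max_right _ _)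
  have hτpos : 0 < τ := two_pos.trans_le hτtwo
  obtain ⟨N₁, hN₁⟩ := hS4 τ hτ1
  obtain ⟨N₂, hN₂⟩ := hS3 τ hτ2
  obtain ⟨N₃, hN₃⟩ := hS6 τ hτ3
  refine ⟨τ, hτpos, max N₁ (max N₂ N₃), fun N hN Φ => ?_⟩
  -- fixed `N`, `Φ`
  have hN1 : N₁ ≤ N := (le_max_left _ _).trans hN
  have hN2 : N₂ ≤ N := ((le_max_left _ _).trans (le_max_right _ _)).trans hN
  have hN3 : N₃ ≤ N := ((le_max_right _ _).trans (le_max_right _ _)).trans hN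
  haveI : IsProbabilityMeasure (gibbs σ a θ u₀ N Φ) :=
    isProbabilityMeasure_localGibbsLaw continuous_const continuous_const continuous_const
      (fun _ => ha) (fun _ => hθ) hσ2 N Φ
  obtain ⟨hBm, hBusy⟩ := hN₁ N hN1 Φ
  obtain ⟨hXm, hJump⟩ := hN₂ N hN2 Φ φ' ψ₀ hφ'c hφ'1 hLip hψc hψb'
  obtain ⟨ℱ, hAd, -, hDef⟩ := hN₃ N hN3 Φ
  -- bookkeeping (S0): increments for Azuma, the Doob identity, the clamp remainder
  obtain ⟨hInc, hDoob, -⟩ := stub_skeletonBookkeeping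
  obtain ⟨hcap, hX0, hXbdd⟩ := hInc θ u₀ φ' ψ₀ c b ⌈k * τ⌉₊ τ r r hc.le hbpos.le hrpos.le σ N Φ
  have hAz := stub_azumaHoeffding (gibbs σ a θ u₀ N Φ) ℱ (procX θ u₀ φ' ψ₀ c b ⌈k * τ⌉₊ τ r r Φ)
    (payloadCap c b r N) hcap hAd hX0 (ae_of_all _ fun z i => hXbdd i z)
    (horizon N ⌈k * τ⌉₊) (-(5 * (window τ N)⁻¹))
  have hM : ∫⁻ z, ENNReal.ofReal (Real.exp (-(5 * (window τ N)⁻¹) *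
      innov a θ u₀ φ' ψ₀ c b ⌈k * τ⌉₊ τ r r Φ ℱ z)) ∂(gibbs σ a θ u₀ N Φ) ≤
      ENNReal.ofReal (Real.exp (δ / 5 * (N + 1))) := by
    refine hAz.trans (ENNReal.ofReal_le_ofReal (Real.exp_le_exp.2 ?_))
    rw [azuma_exponent_eq N ⌈k * τ⌉₊ c b r τ hτpos.ne', ← hQ]
    have hgoal := azuma_exponent_le (K := ⌈k * τ⌉₊) hk hδ hQnn rfl hτtwo hτQ
    have hN0 : (0 : ℝ) ≤ (N : ℝ) + 1 := by positivity
    calc ((N : ℝ) + 1) * (((⌈k * τ⌉₊ : ℝ) + 1) * Q / τ ^ 2) ≤ ((N : ℝ) + 1) * (δ / 5) :=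
          mul_le_mul_of_nonneg_left hgoal hN0
      _ = δ / 5 * ((N : ℝ) + 1) := by ring
  -- the Lipschitz regularisation error at tilt 5
  have hE : ∫⁻ z, ENNReal.ofReal (Real.exp (5 * (obsA θ u₀ φ g τ Φ z - obsA θ u₀ φ' g τ Φ z)))
      ∂(gibbs σ a θ u₀ N Φ) ≤ ENNReal.ofReal (Real.exp (δ / 5 * (N + 1))) := by
    refine (hS2 5 τ hτpos N Φ).trans (ENNReal.ofReal_le_ofReal (Real.exp_le_exp.2 ?_))
    have h5 : |(5 : ℝ)| * η * κ = x := by rw [abs_of_pos (by norm_num : (0 : ℝ) < 5), hηx]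
    rw [h5]
    have hx2 := moll_exponent_le hxpos hx1 hxδ
    have hN0 : (0 : ℝ) ≤ (N : ℝ) + 1 := by positivity
    calc ((N : ℝ) + 1) * (x ^ 2 * Real.exp x / 2) ≤ ((N : ℝ) + 1) * (δ / 5) :=
          mul_le_mul_of_nonneg_left hx2 hN0
      _ = δ / 5 * ((N : ℝ) + 1) := by ring
  exact assemble Φ ℱ hδ (hDoob a θ u₀ φ' ψ₀ g c b ⌈k * τ⌉₊ τ r r σ N Φ ℱ hτpos)
    (fun z hz => clampRem_le (θ := θ) (u₀ := u₀) Φ hz hφ'c hgc hφ'1 hgκ hκpos.le hτpos ⌈k * τ⌉₊)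
    ((aemeasurable_obsA hφc hgc τ Φ).sub (aemeasurable_obsA hφ'c hgc τ Φ)) hE hBm hBusy hXm hJump
    hM hDef

end Composition

/-- The same crux as wanted by route FluxGibbsianityLdDrude (rank 2): its decl is definitionally the
AntiMazurCoboundaries one (byte-identical signatures), so the skeleton concludes it too, by name. -/
theorem KineticFluxLdDecay_of' :
    Summit.AtomisticToContinuum.HydrodynamicLimit.Theses.FluxGibbsianityLdDrude.KineticFluxLdDecay :=
  KineticFluxLdDecay_of

end Summit.AtomisticToContinuum.HydrodynamicLimit.Cruxes.KineticFluxLdDecay.DynkinAzumaCollisionInnovations
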